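import Literature.Computability.QuantumComplexity.ApproxStabilizerRankTransferProofs
import Literature.Computability.QuantumComplexity.StabilizerRankLowerBoundsProofs
import Literature.Computability.QuantumComplexity.CliffordTInverse
import HarnessLib

/-!
# The Clifford circuit monoid is closed under adjoints; stabilizer rank and approximate
  stabilizer rank are Clifford-invariant

Topic `Literature/Computability/QuantumComplexity` (cell qa-dq, census row DQ-B2, literature-typer
RECORD; no line, no fact). The tree's `cliffordCircuits n` (`StabilizerRank.lean`) is the SUBMONOID of
`2ⁿ × 2ⁿ` complex matrices generated by the placements of `H`, `S`, `CNOT` (`Submonoid.closure`), and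
`stabilizerStates n = {C |0ⁿ⟩ : C ∈ cliffordCircuits n}`. What the tree had before this file:
`PelegShpilkaVolk.stabilizerRank_mulVec_le` (`χ(Cψ) ≤ χ(ψ)`),
`ApproxRankTransfer.approxRank_mulVec_le_of_mem_cliffordCircuits` (`χ_δ(Cψ) ≤ χ_δ(ψ)`),
`ApproxRankTransfer.cliffordCircuits_le_unitaryGroup`, and, for the LARGER gate set `cliffordT`,
`cliffordT_isInverseClosed` (`CliffordTInverse.lean`, inverse WORDS of circuits). What was missing
(qa-dq census v1.76 DQ-B2 «Clifford-invariance of χ»; lit-4 g0 2026-08-28: no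
`clifford.IsInverseClosed` / `star_mem_cliffordCircuits`): that `cliffordCircuits n` is closed under
`C ↦ Cᴴ = C⁻¹`, hence is a GROUP of unitaries, and the two EQUALITIES.

Printed statement formalised: "We say two `n`-qubit states `ψ` and `φ` are Clifford-equivalent if
`|ψ⟩ = U|φ⟩` for `U ∈ 𝒞_n`" [cite: PelegShpilkaVolk2022, §5 (definition of Clifford-equivalent)];
"By definition, the stabilizer rank of any two states which are Clifford-equivalent is the same,
and thus the lower bounds of [Theorem 1.1] and [Theorem 1.2] … hold for any state which is
Clifford-equivalent to them" [cite: PelegShpilkaVolk2022, §1 (remark after Theorem 1.2)] — the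
approximate rank included; the Clifford GROUP is generated by `H`, `S` (= `P`), `CNOT`
[cite: AaronsonGottesman2004, §I and §III].

## Contents (all proved; 0 named facts, 0 definitions)

* `clifford_mat_pow_succ_eq_one` — every Clifford gate has finite order: `H² = 1`, `S⁴ = 1`,
  `CNOT² = 1` (tree `hGate_pow_two`, `sGate_pow_four_eq_one`, `cnot_mul_self` by name);
  `clifford_isInverseClosed : clifford.IsInverseClosed` (the `QGateSet`-level statement, as
  `cliffordT_isInverseClosed` for Clifford+T);
* `placeGate_mat_mem_cliffordCircuits`, `conjTranspose_placeGate_clifford_eq_pow` (`Mᴴ = M^j` with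
  `M^{j+1} = 1`, from unitarity), **`conjTranspose_mem_cliffordCircuits`** (`C ∈ 𝒞_n → Cᴴ ∈ 𝒞_n`,
  `Submonoid.closure_induction`), `conjTranspose_mul_self_of_mem_cliffordCircuits`,
  `mul_conjTranspose_self_of_mem_cliffordCircuits`;
* `mem_stabilizerStates_of_mulVec_mem` (`Cψ ∈ Stab → ψ ∈ Stab`), `mulVec_mem_stabilizerStates_iff`;
* **`stabilizerRank_mulVec_eq`** (`χ(Cψ) = χ(ψ)`) and **`approxStabilizerRank_mulVec_eq`**
  (`χ_δ(Cψ) = χ_δ(ψ)`) for every `C ∈ cliffordCircuits n`, every `ψ`, every `δ`.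

HONEST FRAMING: an algebraic closure property of one matrix monoid and two equalities of a cost
MEASURE; nothing about the size of `χ`, about any simulator, or about BQP vs BPP.
-/

namespace Literature.Computability.QuantumComplexity

open _root_.Computability Cryptography Matrix

variable {n : ℕ}

/-! ### Finite orders of the Clifford gates and inverse-closure of the gate set -/

/-- Every Clifford gate has finite order: `H² = 1`, `S⁴ = 1`, `CNOT² = 1`, written uniformly as
`g^{j+1} = 1` for some `j` (`j = 1, 3, 1`). [cite: NielsenChuang2010, §4.2 p. 174 and §1.3.1–1.3.2] -/
theorem clifford_mat_pow_succ_eq_one (g : CliffordOp) :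
    ∃ j : ℕ, (clifford.mat g) ^ (j + 1) = 1 := by
  cases g with
  | H => exact ⟨1, hGate_pow_two⟩
  | S => exact ⟨3, sGate_pow_four_eq_one⟩
  | CNOT => exact ⟨1, by rw [show (1 : ℕ) + 1 = 2 from rfl, sq]; exact cnot_mul_self⟩

/-- **The Clifford gate set `{H, S, CNOT}` is inverse-closed** (`QGateSet.IsInverseClosed`): the
inverse of a placed gate is a product of copies of the same placement (`H⁻¹ = H`, `S⁻¹ = S³`,
`CNOT⁻¹ = CNOT`). [cite: AaronsonGottesman2004, §I (the Clifford group is generated by H, P = S, CNOT)]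
[cite: NielsenChuang2010, §4.2 p. 174] -/
theorem clifford_isInverseClosed : clifford.IsInverseClosed := by
  rintro m M ⟨g, e, rfl⟩
  obtain ⟨j, hj⟩ := clifford_mat_pow_succ_eq_one g
  refine ⟨List.replicate j (placeGate e (clifford.mat g)), fun N hN => ?_, ?_⟩
  · obtain ⟨-, rfl⟩ := List.mem_replicate.1 hN
    exact ⟨g, e, rfl⟩
  · rw [List.prod_replicate, ← pow_succ, ← placeGate_pow_eq_pow, hj, placeGate_one]

/-! ### The Clifford circuit monoid is closed under adjoints -/

/-- A placed Clifford gate is a Clifford circuit (a generator of the closure).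
[cite: AaronsonGottesman2004, §I] -/
theorem placeGate_mat_mem_cliffordCircuits (g : CliffordOp) (e : Fin (clifford.arity g) ↪ Fin n) :
    placeGate e (clifford.mat g) ∈ cliffordCircuits n :=
  Submonoid.subset_closure ⟨g, e, rfl⟩

/-- The adjoint of a placed Clifford gate is a power of it: `Mᴴ = M^j` where `M^{j+1} = 1`
(a unitary of finite order). [cite: NielsenChuang2010, §4.2 p. 174 (H, S, CNOT and their inverses)] -/
theorem conjTranspose_placeGate_clifford_eq_pow (g : CliffordOp) (e : Fin (clifford.arity g) ↪ Fin n) :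
    ∃ j : ℕ, (placeGate e (clifford.mat g))ᴴ = (placeGate e (clifford.mat g)) ^ j := by
  obtain ⟨j, hj⟩ := clifford_mat_pow_succ_eq_one g
  refine ⟨j, ?_⟩
  have hU : placeGate e (clifford.mat g) ∈ Matrix.unitaryGroup (QReg n) ℂ :=
    QGateSet.placements_subset_unitaryGroup_holds ApproxRankTransfer.clifford_isUnitary n ⟨g, e, rfl⟩
  have h1 : (placeGate e (clifford.mat g))ᴴ * placeGate e (clifford.mat g) = 1 := by
    rw [← Matrix.star_eq_conjTranspose]
    exact Matrix.mem_unitaryGroup_iff'.1 hU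
  have hpow : (placeGate e (clifford.mat g)) ^ (j + 1) = 1 := by
    rw [← placeGate_pow_eq_pow, hj, placeGate_one]
  calc (placeGate e (clifford.mat g))ᴴ
      = (placeGate e (clifford.mat g))ᴴ * (placeGate e (clifford.mat g)) ^ (j + 1) := by
        rw [hpow, Matrix.mul_one]
    _ = (placeGate e (clifford.mat g))ᴴ * placeGate e (clifford.mat g) *
          (placeGate e (clifford.mat g)) ^ j := by
        rw [pow_succ', Matrix.mul_assoc]
    _ = (placeGate e (clifford.mat g)) ^ j := by rw [h1, Matrix.one_mul]

/-- **The Clifford circuit monoid is closed under adjoints**: `C ∈ 𝒞_n → Cᴴ ∈ 𝒞_n`. Hence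
`cliffordCircuits n` is a group of unitaries (the adjoint is the inverse,
`conjTranspose_mul_self_of_mem_cliffordCircuits`). [cite: AaronsonGottesman2004, §I and §III (the Clifford GROUP generated by H, P, CNOT)] -/
theorem conjTranspose_mem_cliffordCircuits {C : Matrix (QReg n) (QReg n) ℂ} (hC : C ∈ cliffordCircuits n) :
    Cᴴ ∈ cliffordCircuits n := by
  induction hC using Submonoid.closure_induction with
  | mem M hM =>
    obtain ⟨g, e, rfl⟩ := hM
    obtain ⟨j, hj⟩ := conjTranspose_placeGate_clifford_eq_pow (n := n) g e
    rw [hj]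
    exact pow_mem (placeGate_mat_mem_cliffordCircuits g e) j
  | one => rw [Matrix.conjTranspose_one]; exact Submonoid.one_mem _
  | mul x y _ _ hx hy => rw [Matrix.conjTranspose_mul]; exact Submonoid.mul_mem _ hy hx

/-- `Cᴴ C = 1` for a Clifford circuit. [cite: NielsenChuang2010, §2.1.6 (unitary operators)] -/
theorem conjTranspose_mul_self_of_mem_cliffordCircuits {C : Matrix (QReg n) (QReg n) ℂ}
    (hC : C ∈ cliffordCircuits n) : Cᴴ * C = 1 := by
  rw [← Matrix.star_eq_conjTranspose]
  exact Matrix.mem_unitaryGroup_iff'.1 (ApproxRankTransfer.cliffordCircuits_le_unitaryGroup n hC)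

/-- `C Cᴴ = 1` for a Clifford circuit. [cite: NielsenChuang2010, §2.1.6 (unitary operators)] -/
theorem mul_conjTranspose_self_of_mem_cliffordCircuits {C : Matrix (QReg n) (QReg n) ℂ}
    (hC : C ∈ cliffordCircuits n) : C * Cᴴ = 1 := by
  rw [← Matrix.star_eq_conjTranspose]
  exact Matrix.mem_unitaryGroup_iff.1 (ApproxRankTransfer.cliffordCircuits_le_unitaryGroup n hC)

/-- Undoing a Clifford circuit: `Cᴴ (C ψ) = ψ`. [cite: NielsenChuang2010, §2.1.6] -/
theorem conjTranspose_mulVec_mulVec_of_mem_cliffordCircuits {C : Matrix (QReg n) (QReg n) ℂ}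
    (hC : C ∈ cliffordCircuits n) (ψ : QReg n → ℂ) : Cᴴ *ᵥ (C *ᵥ ψ) = ψ := by
  rw [Matrix.mulVec_mulVec, conjTranspose_mul_self_of_mem_cliffordCircuits hC, Matrix.one_mulVec]

/-! ### Stabilizer states, stabilizer rank and approximate rank are Clifford-invariant -/

/-- If `C ψ` is a stabilizer state for a Clifford circuit `C`, so is `ψ` (apply `Cᴴ ∈ 𝒞_n`).
[cite: AaronsonGottesman2004, Thm. 1 (stabilizer states = Clifford orbit of |0ⁿ⟩)] -/
theorem mem_stabilizerStates_of_mulVec_mem {C : Matrix (QReg n) (QReg n) ℂ} (hC : C ∈ cliffordCircuits n)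
    {ψ : QReg n → ℂ} (h : C *ᵥ ψ ∈ stabilizerStates n) : ψ ∈ stabilizerStates n := by
  rw [← conjTranspose_mulVec_mulVec_of_mem_cliffordCircuits hC ψ]
  exact mulVec_mem_stabilizerStates (conjTranspose_mem_cliffordCircuits hC) h

/-- `C ψ ∈ Stab ↔ ψ ∈ Stab` for a Clifford circuit `C`.
[cite: AaronsonGottesman2004, Thm. 1 (stabilizer states = Clifford orbit of |0ⁿ⟩)] -/
theorem mulVec_mem_stabilizerStates_iff {C : Matrix (QReg n) (QReg n) ℂ} (hC : C ∈ cliffordCircuits n)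
    (ψ : QReg n → ℂ) : C *ᵥ ψ ∈ stabilizerStates n ↔ ψ ∈ stabilizerStates n :=
  ⟨mem_stabilizerStates_of_mulVec_mem hC, mulVec_mem_stabilizerStates hC⟩

/-- **Stabilizer rank is Clifford-invariant**: `χ(C ψ) = χ(ψ)` for every Clifford circuit `C`
("the stabilizer rank of any two states which are Clifford-equivalent is the same").
[cite: PelegShpilkaVolk2022, §1 (remark after Theorem 1.2) and §5 (Clifford-equivalent states)] -/
theorem stabilizerRank_mulVec_eq {C : Matrix (QReg n) (QReg n) ℂ} (hC : C ∈ cliffordCircuits n)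
    (ψ : QReg n → ℂ) : stabilizerRank (C *ᵥ ψ) = stabilizerRank ψ := by
  refine le_antisymm (PelegShpilkaVolk.stabilizerRank_mulVec_le hC ψ) ?_
  have h := PelegShpilkaVolk.stabilizerRank_mulVec_le (conjTranspose_mem_cliffordCircuits hC) (C *ᵥ ψ)
  rwa [conjTranspose_mulVec_mulVec_of_mem_cliffordCircuits hC ψ] at h

/-- **Approximate stabilizer rank is Clifford-invariant**: `χ_δ(C ψ) = χ_δ(ψ)` for every Clifford
circuit `C` and every `δ` (Cliffords are unitary, so `δ`-approximants are transported both ways; the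
printed remark covers the approximate rank: the lower bound of Theorem 1.2 "hold[s] for any state
which is Clifford-equivalent"). [cite: PelegShpilkaVolk2022, §1 (remark after Theorem 1.2)]
[cite: BravyiEtAl2019, §2 (approximate stabilizer rank)] -/
theorem approxStabilizerRank_mulVec_eq {C : Matrix (QReg n) (QReg n) ℂ} (hC : C ∈ cliffordCircuits n)
    (δ : ℝ) (ψ : QReg n → ℂ) : approxStabilizerRank δ (C *ᵥ ψ) = approxStabilizerRank δ ψ := by
  refine le_antisymm (ApproxRankTransfer.approxRank_mulVec_le_of_mem_cliffordCircuits hC δ ψ) ?_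
  have h := ApproxRankTransfer.approxRank_mulVec_le_of_mem_cliffordCircuits
    (conjTranspose_mem_cliffordCircuits hC) δ (C *ᵥ ψ)
  rwa [conjTranspose_mulVec_mulVec_of_mem_cliffordCircuits hC ψ] at h

end Literature.Computability.QuantumComplexity
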